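import Summits.CriticalPhenomena.PercolationContinuityZ3.Theorems.PercNearOneGluingAdditiveGluingSetObserverLemmaT
import HarnessLib

/-!
# Conjecture G / SET-W via a SET observer, X: Theorem 1-set from the one-level unfolding step (induction skeleton)

Support file (`--supports stmt-CriticalPhenomena-4576`); no definitions, no named facts, no sorries.  Seat (b) V⁺-form `png-dp-vplus`, gen 12
(memo MEMO-gen12.md §4(e), §10 (I)).  Set-observer version of prim-png-lead's `CSH.cshMargin_nonneg_of_unfold` / `cshHolds_of_unfold`
(`…AdditiveGluingCSHInduction.lean`): strong induction on the number of decoys with LEMMA T-set (`CSHSet.cshMarginSet_nonneg_of_within`) at every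
level (level `0` included — for a set observer level `0` is (K6-set) + (Htw-set), part of the hypothesis).
* `CSHSet.cshMarginSet_nonneg_of_unfold`, `CSHSet.cshSetHolds_of_unfold` — `CSHSetHolds` for every datum (weights `< 1`) from the ONE-LEVEL UNFOLDING STEP
  `hU` (= Lemmas U-set + H-set of the memo: the world-wise margin is `≥` Hpart-set `+` a nonnegative combination of lower-level CSH-set margins; the new
  ingredients `CSH.sum_resid_obs_le` (defect lemma) and `SetSurplus.covTransfer_relaySet_edge_set` ((K6-set)) are in the tree).
With `…SetObserverAssembly.lean`: conjecture G (`stub_fingerML3_vp`, K < 1) ⟸ `hU`.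
[cite: VandenbergHaggstromKahn2005, §2.1 (pp. 9–13)] [cite: KozmaNitzan2024, Conj. 4 (p. 32)]
-/

noncomputable section

namespace Summit.CriticalPhenomena.PercolationContinuityZ3.Theorems

open MeasureTheory Set Literature.Probability.LatticeModels Literature.Probability.Percolation
open scoped Classical

namespace CSHSet

open CSH Literature.Probability.Percolation.BHK2006

variable {V : Type*} [Fintype V]

/-- **Theorem 1-set from the one-level unfolding step** (set-observer version of `CSH.cshMargin_nonneg_of_unfold`; strong induction on the number of
decoys, Lemma T-set at every level).  Weights `< 1`.  HYPOTHESIS `hU` (= Lemmas U-set + H-set of the memo, §4(b)–(d)): for every datum (owner `x`, avoided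
set `Y`, decoy list `D` — possibly empty —, set observer `O`, vertex observer `v`, named vertices distinct and outside `O`), IF every lower-level margin
`cshMarginSet w d ({x} ∪ Y ∪ pre) ds' O v h` (`D = pre ++ d :: ds'`, `h` monotone `≥ 0`) is nonnegative, THEN the world-wise margin of
`cshMarginSet_nonneg_of_within` is nonnegative for every monotone `g ≥ 0`.  CONCLUSION: `0 ≤ cshMarginSet w x Y D O v f` for every such datum and every
monotone `f`. [cite: VandenbergHaggstromKahn2005, §2.1 (pp. 9–13)] [cite: KozmaNitzan2024, Conj. 4 (p. 32)] -/
theorem cshMarginSet_nonneg_of_unfold (w : Sym2 V → unitInterval) (hw : ∀ e, w e < 1) (O : Finset V)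
    (hU : ∀ (x : V) (Y : Set V) (D : List V) (v : V),
      x ∉ Y → v ∉ insert x Y → D.Nodup → (∀ d ∈ D, d ∉ insert x Y ∧ d ≠ v) →
      (∀ o ∈ O, o ∉ insert x Y ∧ o ≠ v ∧ o ∉ D) →
      (∀ (pre : List V) (d : V) (ds' : List V), D = pre ++ d :: ds' →
        ∀ h : Set (Sym2 V) → ℝ, Monotone h → (∀ C, 0 ≤ h C) →
          0 ≤ cshMarginSet w d (insert x Y ∪ {e | e ∈ pre}) ds' O v h) →
      ∀ g : Set (Sym2 V) → ℝ, Monotone g → (∀ C, 0 ≤ g C) →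
      (0 : ℝ) ≤ ∫ ω in {ω : BondConfig V | ∀ y ∈ Y, ¬ (openGraph ω).Reachable x y},
        cshMarg (decoyListSet w O (insert x Y) D) (obsConstSet w O v (insert x Y ∪ {d | d ∈ D})) none (some v)
          (fun s => (∫ η in {η : BondConfig V | match s with
                | none => (∃ o ∈ O, (openGraph η).Reachable o x) ∧ ∀ o ∈ O, ¬ (o ∈ Y ∨ ∃ e ∈ setCl ω Y, o ∈ e)
                | some u => (openGraph η).Reachable x u}, g (openEdgeCluster η x)
                ∂(prodBernoulli fun e => if (∃ z ∈ e, ∃ y ∈ Y, (openGraph ω).Reachable y z)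
                  then (0 : unitInterval) else w e)) -
              (∫ η, g (openEdgeCluster η x)
                ∂(prodBernoulli fun e => if (∃ z ∈ e, ∃ y ∈ Y, (openGraph ω).Reachable y z)
                  then (0 : unitInterval) else w e)) *
              (prodBernoulli fun e => if (∃ z ∈ e, ∃ y ∈ Y, (openGraph ω).Reachable y z)
                  then (0 : unitInterval) else w e).real {η : BondConfig V | match s with
                | none => (∃ o ∈ O, (openGraph η).Reachable o x) ∧ ∀ o ∈ O, ¬ (o ∈ Y ∨ ∃ e ∈ setCl ω Y, o ∈ e)
                | some u => (openGraph η).Reachable x u})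
        ∂(prodBernoulli w)) :
    ∀ (D : List V) (x : V) (Y : Set V) (v : V),
      x ∉ Y → v ∉ insert x Y → D.Nodup → (∀ d ∈ D, d ∉ insert x Y ∧ d ≠ v) → (∀ o ∈ O, o ∉ insert x Y ∧ o ≠ v ∧ o ∉ D) →
      ∀ f : Set (Sym2 V) → ℝ, Monotone f → 0 ≤ cshMarginSet w x Y D O v f := by
  suffices hk : ∀ (k : ℕ) (D : List V), D.length ≤ k → ∀ (x : V) (Y : Set V) (v : V),
      x ∉ Y → v ∉ insert x Y → D.Nodup → (∀ d ∈ D, d ∉ insert x Y ∧ d ≠ v) → (∀ o ∈ O, o ∉ insert x Y ∧ o ≠ v ∧ o ∉ D) →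
      ∀ f : Set (Sym2 V) → ℝ, Monotone f → 0 ≤ cshMarginSet w x Y D O v f from
    fun D => hk D.length D le_rfl
  intro k
  induction k with
  | zero =>
    intro D hD x Y v hxY hv hnd hdis hO f hf
    have hD0 : D = [] := List.eq_nil_of_length_eq_zero (Nat.le_zero.1 hD)
    subst hD0
    have hY : ∀ e : Sym2 V, ¬ e.IsDiag → (∃ u ∈ e, u ∈ Y) → (w e : ℝ) < 1 := fun e _ _ => unitInterval.coe_lt_one.2 (hw e)
    refine cshMarginSet_nonneg_of_within w x Y [] O v hY (fun g hg hg0 => ?_) f hf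
    exact hU x Y [] v hxY hv List.nodup_nil (fun d hd => by simp at hd) hO (fun pre d ds' hsplit => by simp at hsplit) g hg hg0
  | succ k ih =>
    intro D hD x Y v hxY hv hnd hdis hO f hf
    have hY : ∀ e : Sym2 V, ¬ e.IsDiag → (∃ u ∈ e, u ∈ Y) → (w e : ℝ) < 1 := fun e _ _ => unitInterval.coe_lt_one.2 (hw e)
    refine cshMarginSet_nonneg_of_within w x Y D O v hY (fun g hg hg0 => ?_) f hf
    refine hU x Y D v hxY hv hnd hdis hO (fun pre d ds' hsplit h hh hh0 => ?_) g hg hg0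
    have hlen : ds'.length ≤ k := by
      have : D.length = pre.length + (ds'.length + 1) := by rw [hsplit, List.length_append, List.length_cons]
      omega
    have hdD : d ∈ D := by rw [hsplit]; exact List.mem_append_right pre List.mem_cons_self
    have hpreD : ∀ e ∈ pre, e ∈ D := fun e he => by rw [hsplit]; exact List.mem_append_left _ he
    have hds'D : ∀ e ∈ ds', e ∈ D := fun e he => by rw [hsplit]; exact List.mem_append_right pre (List.mem_cons_of_mem d he)
    have hnd' : (pre ++ d :: ds').Nodup := hsplit ▸ hnd
    have hnd_ds' : ds'.Nodup := (List.nodup_cons.1 (List.nodup_append.1 hnd').2.1).2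
    have hd_notin_ds' : d ∉ ds' := (List.nodup_cons.1 (List.nodup_append.1 hnd').2.1).1
    have hd_notin_pre : d ∉ pre := fun hdp => (List.nodup_append.1 hnd').2.2 d hdp d List.mem_cons_self rfl
    have hds'_notin_pre : ∀ e ∈ ds', e ∉ pre := fun e he hep =>
      (List.nodup_append.1 hnd').2.2 e hep e (List.mem_cons_of_mem d he) rfl
    set Y' : Set V := insert x Y ∪ {e | e ∈ pre} with hY'
    have hdY' : d ∉ Y' := by
      rintro (h1 | h2)
      · exact (hdis d hdD).1 h1
      · exact hd_notin_pre h2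
    have hvY' : v ∉ insert d Y' := by
      rintro (h0 | h1 | h2)
      · exact (hdis d hdD).2 h0.symm
      · exact hv h1
      · exact (hdis v (hpreD v h2)).2 rfl
    have hdis' : ∀ e ∈ ds', e ∉ insert d Y' ∧ e ≠ v := by
      intro e he
      refine ⟨?_, (hdis e (hds'D e he)).2⟩
      rintro (h0 | h1 | h2)
      · exact hd_notin_ds' (h0 ▸ he)
      · exact (hdis e (hds'D e he)).1 h1
      · exact hds'_notin_pre e he h2
    have hO' : ∀ o ∈ O, o ∉ insert d Y' ∧ o ≠ v ∧ o ∉ ds' := by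
      intro o ho
      refine ⟨?_, (hO o ho).2.1, fun h => (hO o ho).2.2 (hds'D o h)⟩
      rintro (h0 | h1 | h2)
      · exact (hO o ho).2.2 (h0 ▸ hdD)
      · exact (hO o ho).1 h1
      · exact (hO o ho).2.2 (hpreD o h2)
    exact ih ds' hlen d Y' v hdY' hvY' hnd_ds' hdis' hO' h hh

/-- **`CSHSetHolds` for every datum from the one-level unfolding step** (wrapper; the hypothesis shape of `preMarginSet_nonneg_of_cshSet` /
`fingerML3_of_cshSet`). [cite: KozmaNitzan2024, Conj. 4 (p. 32)] -/
theorem cshSetHolds_of_unfold (w : Sym2 V → unitInterval) (hw : ∀ e, w e < 1) (O : Finset V)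
    (hU : ∀ (x : V) (Y : Set V) (D : List V) (v : V),
      x ∉ Y → v ∉ insert x Y → D.Nodup → (∀ d ∈ D, d ∉ insert x Y ∧ d ≠ v) →
      (∀ o ∈ O, o ∉ insert x Y ∧ o ≠ v ∧ o ∉ D) →
      (∀ (pre : List V) (d : V) (ds' : List V), D = pre ++ d :: ds' →
        ∀ h : Set (Sym2 V) → ℝ, Monotone h → (∀ C, 0 ≤ h C) →
          0 ≤ cshMarginSet w d (insert x Y ∪ {e | e ∈ pre}) ds' O v h) →
      ∀ g : Set (Sym2 V) → ℝ, Monotone g → (∀ C, 0 ≤ g C) →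
      (0 : ℝ) ≤ ∫ ω in {ω : BondConfig V | ∀ y ∈ Y, ¬ (openGraph ω).Reachable x y},
        cshMarg (decoyListSet w O (insert x Y) D) (obsConstSet w O v (insert x Y ∪ {d | d ∈ D})) none (some v)
          (fun s => (∫ η in {η : BondConfig V | match s with
                | none => (∃ o ∈ O, (openGraph η).Reachable o x) ∧ ∀ o ∈ O, ¬ (o ∈ Y ∨ ∃ e ∈ setCl ω Y, o ∈ e)
                | some u => (openGraph η).Reachable x u}, g (openEdgeCluster η x)
                ∂(prodBernoulli fun e => if (∃ z ∈ e, ∃ y ∈ Y, (openGraph ω).Reachable y z)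
                  then (0 : unitInterval) else w e)) -
              (∫ η, g (openEdgeCluster η x)
                ∂(prodBernoulli fun e => if (∃ z ∈ e, ∃ y ∈ Y, (openGraph ω).Reachable y z)
                  then (0 : unitInterval) else w e)) *
              (prodBernoulli fun e => if (∃ z ∈ e, ∃ y ∈ Y, (openGraph ω).Reachable y z)
                  then (0 : unitInterval) else w e).real {η : BondConfig V | match s with
                | none => (∃ o ∈ O, (openGraph η).Reachable o x) ∧ ∀ o ∈ O, ¬ (o ∈ Y ∨ ∃ e ∈ setCl ω Y, o ∈ e)
                | some u => (openGraph η).Reachable x u})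
        ∂(prodBernoulli w))
    (x : V) (Y : Set V) (D : List V) (v : V)
    (hxY : x ∉ Y) (hv : v ∉ insert x Y) (hnd : D.Nodup) (hdis : ∀ d ∈ D, d ∉ insert x Y ∧ d ≠ v)
    (hO : ∀ o ∈ O, o ∉ insert x Y ∧ o ≠ v ∧ o ∉ D) :
    CSHSetHolds w x Y D O v :=
  fun f hf => cshMarginSet_nonneg_of_unfold w hw O hU D x Y v hxY hv hnd hdis hO f hf

end CSHSet

end Summit.CriticalPhenomena.PercolationContinuityZ3.Theorems

end
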